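import Literature.NumberTheory.EllipticCurves.ModularSymbolsManin
import Literature.NumberTheory.EllipticCurves.ModularSymbolsManinRelations
import Literature.NumberTheory.EllipticCurves.ModularSymbolsPStabilisation
import HarnessLib

/-!
# The classical weight-`2` modular symbol of a cusp form as an element of `Symb_{Γ₀(N)}`

For `h ∈ S₂(Γ₀(N))` the tree's modular symbols `{∞, r}_h` (`ModularSymbols.modularSymbol`) and
`{∞, k∞}_h` (`ModularSymbolsManin.inftySymbol`) assemble into a POTENTIAL on `ℙ¹(ℚ)`
(`msPot h`, `msPot_infty`, `msPot_ofRat`, `msPot_act_sl_infty`) and hence, through the potential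
form of additive functions of pairs of cusps (`ModularSymbolsGreenbergLifting.potential_mem_modSym`
pattern), into the **classical weight-`2` symbol**
`clSymb h (x, y) = {∞, y}_h − {∞, x}_h = {x, y}_h ∈ Symb_{Γ₀(N)}(Sym⁰ ℂ)` (`clSymb`, `clSymb_mem_Symb`):
the `Γ₀(N)`-invariance is the tree's Manin relation `{∞, γk∞} = {∞, γ∞} + {∞, k∞}`
(`inftySymbol_mul_of_mem`).  The abstract Hecke operator of `ModularSymbolsCoefficients` acts
through the tree's `T_p` on cusp forms — **`T_p (clSymb h) = clSymb (T_p h)`** (`hecke_clSymb`,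
from `modularSymbol_heckeT_eq_sum`, Cremona (2.4.1)) — so a `T_p`-eigenform gives a
`T_p`-eigensymbol (`hecke_clSymb_of_eigen`) and, by `ModularSymbolsPStabilisation.symPow_pStabilise`,
for `p ∤ N` and a non-zero root `α` of `X² − a_p X + p` the **`p`-stabilised `U_p`-eigensymbol
`clSymb h − α⁻¹ (clSymb h)|δ ∈ Symb_{Γ₀(Np)}(Sym⁰ ℂ)` with eigenvalue `α`** (`clSymb_pStabilise`) — the
symbol of `h_α(z) = h(z) − (p/α) h(pz)` whose ordinary measure-valued lift
(`ModularSymbolsOrdinaryMeasuresApprox.existsUnique_measureValued_eigensymbol_of_exact`) carries the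
Mazur–Tate–Teitelbaum measure `μ_{h,α}` (Mazur–Tate–Teitelbaum 1986, §I.10).

Everything is proved; no named facts.

## References

* J. E. Cremona, *Algorithms for modular elliptic curves* (1997), §2.1–§2.4. [CremonaAlgorithms1997]
* B. Mazur, J. Tate, J. Teitelbaum, Invent. Math. 84 (1986), §I.10. [MazurTateTeitelbaum1986Invent]
* Ju. I. Manin, Izv. Akad. Nauk SSSR 36 (1972), §1.4–§1.7. [Manin1972]
-/

noncomputable section

open scoped MatrixGroups ModularForm
open Matrix CongruenceSubgroup

namespace Literature.NumberTheory.EllipticCurves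

open ModularForms ModularForms.HidaCohomology

/-! ### Every cusp is `k∞` -/

/-- **Every cusp is `k∞` for some `k ∈ SL(2, ℤ)`.** [folklore] -/
theorem P1Q.exists_sl_act_infty (x : P1Q) : ∃ k : SL(2, ℤ), P1Q.act (k : Matrix (Fin 2) (Fin 2) ℤ) P1Q.infty = x := by
  rcases P1Q.infty_or_ofRat x with rfl | ⟨r, rfl⟩
  · exact ⟨1, by rw [Matrix.SpecialLinearGroup.coe_one, P1Q.act_one]; rfl⟩
  · obtain ⟨a, c, hc, hcop, hr⟩ := P1Q.exists_coprime_eq_ofRat r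
    obtain ⟨u, v, huv⟩ := hcop
    refine ⟨P1Q.sl2 a (-v) c u (by linear_combination huv), ?_⟩
    rw [P1Q.act_sl_infty, hr]
    change P1Q.cuspOf (P1Q.mat2 a (-v) c u 0 0) (P1Q.mat2 a (-v) c u 1 0) = _
    simp only [P1Q.mat2, Matrix.of_apply, Matrix.cons_val', Matrix.cons_val_zero, Matrix.cons_val_one, Matrix.cons_val_fin_one]
    exact P1Q.cuspOf_of_ne_zero a (by exact_mod_cast (by omega : c ≠ 0))

/-! ### The potential `x ↦ {∞, x}_h` -/

section Potential

variable {N : ℕ} (h : CuspForm (Gamma0 N) 2)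

open Classical in
/-- **The potential `{∞, x}_h` on `ℙ¹(ℚ)`**: `{∞, r}_h` at a finite cusp, `0` at `∞`. [cite: Manin1972, §1.4] -/
def msPot (x : P1Q) : ℂ :=
  if hx : ∃ r : ℚ, x = P1Q.ofRat r then modularSymbol h hx.choose else 0

/-- `{∞, ∞} = 0`. [folklore] -/
theorem msPot_infty : msPot h P1Q.infty = 0 := by
  have hn : ¬ ∃ r : ℚ, P1Q.infty = P1Q.ofRat r := fun ⟨r, hr⟩ => ofRat_ne_infty r hr.symm
  unfold msPot
  rw [dif_neg hn]

/-- `{∞, r}` at a finite cusp. [folklore] -/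
theorem msPot_ofRat (r : ℚ) : msPot h (P1Q.ofRat r) = modularSymbol h r := by
  have hx : ∃ r' : ℚ, P1Q.ofRat r = P1Q.ofRat r' := ⟨r, rfl⟩
  have hr : hx.choose = r := (ofRat_injective hx.choose_spec).symm
  unfold msPot
  rw [dif_pos hx, hr]

/-- `msPot` on `cuspOf a c`. [folklore] -/
theorem msPot_cuspOf (a c : ℤ) : msPot h (P1Q.cuspOf a c) = if c = 0 then 0 else modularSymbol h ((a : ℚ) / (c : ℚ)) := by
  by_cases hc : c = 0
  · rw [hc, P1Q.cuspOf_zero, msPot_infty, if_pos rfl]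
  · rw [P1Q.cuspOf_of_ne_zero a hc, msPot_ofRat, if_neg hc]

/-- **`{∞, k∞}_h`**: the potential at `k∞` is the tree's `inftySymbol h k`. [folklore] -/
theorem msPot_act_sl_infty (k : SL(2, ℤ)) : msPot h (P1Q.act (k : Matrix (Fin 2) (Fin 2) ℤ) P1Q.infty) = inftySymbol h k := by
  rw [P1Q.act_sl_infty, msPot_cuspOf, inftySymbol]

/-- **The Manin relation for the potential**: `{∞, γx} = {∞, γ∞} + {∞, x}` for `γ ∈ Γ₀(N)`. [cite: Manin1972, Prop. 1.4] -/
theorem msPot_act_gamma0 [NeZero N] {γ : SL(2, ℤ)} (hγ : γ ∈ Gamma0 N) (x : P1Q) :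
    msPot h (P1Q.act (γ : Matrix (Fin 2) (Fin 2) ℤ) x) = cuspSymbol h ⟨γ, hγ⟩ + msPot h x := by
  obtain ⟨k, rfl⟩ := P1Q.exists_sl_act_infty x
  rw [P1Q.act_act (P1Q.det_coe_sl_ne_zero γ) (P1Q.det_coe_sl_ne_zero k), ← Matrix.SpecialLinearGroup.coe_mul, msPot_act_sl_infty,
    msPot_act_sl_infty, inftySymbol_mul_of_mem h hγ k]

/-- `msPot` is additive in the form. [folklore] -/
theorem msPot_add [NeZero N] (h₁ h₂ : CuspForm (Gamma0 N) 2) (x : P1Q) : msPot (h₁ + h₂) x = msPot h₁ x + msPot h₂ x := by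
  rcases P1Q.infty_or_ofRat x with rfl | ⟨r, rfl⟩
  · rw [msPot_infty, msPot_infty, msPot_infty, add_zero]
  · rw [msPot_ofRat, msPot_ofRat, msPot_ofRat, modularSymbol_add]

/-- `msPot` is homogeneous in the form. [folklore] -/
theorem msPot_smul (c : ℂ) (x : P1Q) : msPot (c • h) x = c * msPot h x := by
  rcases P1Q.infty_or_ofRat x with rfl | ⟨r, rfl⟩
  · rw [msPot_infty, msPot_infty, mul_zero]
  · rw [msPot_ofRat, msPot_ofRat, modularSymbol_const_smul]

end Potential

/-! ### The classical symbol -/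

section ClSymb

variable {N : ℕ} (h : CuspForm (Gamma0 N) 2) (S : Set (Matrix (Fin 2) (Fin 2) ℤ))

/-- **The classical weight-`2` modular symbol `{x, y}_h = {∞, y}_h − {∞, x}_h`** with values in
`Sym⁰ ℂ = (Fin 1 → ℂ)`. [cite: Manin1972, §1.4] -/
def clSymb : P1Q → P1Q → (Fin 1 → ℂ) := fun x y _ => msPot h y - msPot h x

/-- Unfolding `clSymb`. [folklore] -/
@[simp] theorem clSymb_apply (x y : P1Q) (i : Fin 1) : clSymb h x y i = msPot h y - msPot h x := rfl

/-- The slash action of `Sym⁰` on functions of pairs of cusps is by transport of the cusps only. [folklore] -/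
theorem symPowOn_zero_slash_apply (M : Matrix (Fin 2) (Fin 2) ℤ) (φ : P1Q → P1Q → (Fin 1 → ℂ)) (x y : P1Q) :
    (CoeffActionOn.symPowOn S 0 ℂ).slash M φ x y = φ (P1Q.act M x) (P1Q.act M y) := by
  rw [CoeffActionOn.slash_apply]
  change act 0 M (φ (P1Q.act M x) (P1Q.act M y)) = _
  rw [act_zero_eq_id, LinearMap.id_apply]

/-- **`{x, y}_h ∈ Symb_{Γ₀(N)}(Sym⁰ ℂ)`**: additive (a potential) and `Γ₀(N)`-invariant (Manin).
[cite: Manin1972, Prop. 1.4, Thm. 1.6] -/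
theorem clSymb_mem_Symb [NeZero N] : clSymb h ∈ (CoeffActionOn.symPowOn S 0 ℂ).Symb (Gamma0 N) := by
  refine ⟨(mem_modSym_iff (R := ℂ)).mpr fun x y z => ?_, fun γ hγ => ?_⟩
  · funext i
    simp only [Pi.add_apply, clSymb_apply]
    ring
  · funext x y i
    rw [symPowOn_zero_slash_apply, clSymb_apply, clSymb_apply, msPot_act_gamma0 h hγ, msPot_act_gamma0 h hγ]
    ring

/-- `clSymb` is additive in the form. [folklore] -/
theorem clSymb_add [NeZero N] (h₁ h₂ : CuspForm (Gamma0 N) 2) : clSymb (h₁ + h₂) = clSymb h₁ + clSymb h₂ := by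
  funext x y i
  simp only [clSymb_apply, Pi.add_apply, msPot_add]
  ring

/-- `clSymb` is homogeneous in the form. [folklore] -/
theorem clSymb_smul (c : ℂ) : clSymb (c • h) = c • clSymb h := by
  funext x y i
  simp only [clSymb_apply, Pi.smul_apply, smul_eq_mul, msPot_smul]
  ring

end ClSymb

/-! ### The Hecke operator -/

/-- **`g · r = (ar + b)/(cr + d)`** on `ℙ¹(ℚ)` when `cr + d ≠ 0`. [folklore] -/
theorem P1Q.act_ofRat_eq {g : Matrix (Fin 2) (Fin 2) ℤ} (hg : g.det ≠ 0) (r : ℚ) (hden : (g 1 0 : ℚ) * r + (g 1 1 : ℚ) ≠ 0) :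
    P1Q.act g (P1Q.ofRat r) = P1Q.ofRat (((g 0 0 : ℚ) * r + (g 0 1 : ℚ)) / ((g 1 0 : ℚ) * r + (g 1 1 : ℚ))) := by
  rw [P1Q.ofRat, P1Q.act_mk hg]
  have hv : P1Q.ratMat g *ᵥ ![r, 1] = ![(g 0 0 : ℚ) * r + g 0 1, (g 1 0 : ℚ) * r + g 1 1] := by
    funext i
    fin_cases i <;> simp [Matrix.mulVec, dotProduct, Fin.sum_univ_two]
  have h1 : (P1Q.ratMat g *ᵥ ![r, 1]) 1 ≠ 0 := by rw [hv]; exact hden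
  refine (P1Q.mk_eq_ofRat _ h1).trans ?_
  simp only [hv, Matrix.cons_val_zero, Matrix.cons_val_one, Matrix.cons_val_fin_one]

section Hecke

variable {N : ℕ} (h : CuspForm (Gamma0 N) 2) (S : Set (Matrix (Fin 2) (Fin 2) ℤ)) {p : ℕ} [Fact p.Prime]

/-- `βⱼ · r = (r + j)/p` on finite cusps. [folklore] -/
theorem act_heckeRep_some_ofRat (j : ZMod p) (r : ℚ) :
    P1Q.act (heckeRep p (some j)) (P1Q.ofRat r) = P1Q.ofRat ((r + ((j.val : ℕ) : ℤ)) / p) := by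
  have hp0 : (p : ℚ) ≠ 0 := by exact_mod_cast (Fact.out : p.Prime).ne_zero
  have hdet : (heckeRep p (some j)).det ≠ 0 := by rw [det_heckeRep]; exact_mod_cast (Fact.out : p.Prime).ne_zero
  rw [P1Q.act_ofRat_eq hdet r (by simp [heckeRep]; exact (Fact.out : p.Prime).ne_zero)]
  congr 1
  simp [heckeRep]

/-- `βⱼ · ∞ = ∞`. [folklore] -/
theorem act_heckeRep_some_infty (j : ZMod p) : P1Q.act (heckeRep p (some j)) P1Q.infty = P1Q.infty := by
  have hp0 : (p : ℤ) ≠ 0 := by exact_mod_cast (Fact.out : p.Prime).ne_zero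
  rw [show heckeRep p (some j) = P1Q.mat2 1 (j.val : ℤ) 0 (p : ℤ) from rfl]
  exact P1Q.mat2_act_infty_of_eq_zero (by rw [mul_zero, sub_zero, one_mul]; exact hp0)

/-- `δ · r = p r` on finite cusps. [folklore] -/
theorem act_deltaMat_ofRat (r : ℚ) : P1Q.act (deltaMat p) (P1Q.ofRat r) = P1Q.ofRat ((p : ℚ) * r) := by
  have hdet : (deltaMat p).det ≠ 0 := by rw [det_deltaMat]; exact_mod_cast (Fact.out : p.Prime).ne_zero
  rw [P1Q.act_ofRat_eq hdet r (by simp)]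
  congr 1
  simp

/-- `δ · ∞ = ∞`. [folklore] -/
theorem act_deltaMat_infty : P1Q.act (deltaMat p) P1Q.infty = P1Q.infty := by
  have hp0 : (p : ℤ) ≠ 0 := by exact_mod_cast (Fact.out : p.Prime).ne_zero
  rw [show deltaMat p = P1Q.mat2 (p : ℤ) 0 0 1 from rfl]
  exact P1Q.mat2_act_infty_of_eq_zero (by rw [mul_one, mul_zero, sub_zero]; exact hp0)

/-- **The potential of `T_p h`**: `{∞, x}_{T_p h} = Σ_{j mod p} {∞, βⱼx}_h + 𝟙_{p∤N} {∞, δx}_h`.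
[cite: CremonaAlgorithms1997, §2.4 (2.4.1)] -/
theorem msPot_heckeT [NeZero N] (x : P1Q) :
    msPot (heckeT (Gamma0 N) 2 p h) x =
      ∑ j : ZMod p, msPot h (P1Q.act (heckeRep p (some j)) x) + if p ∣ N then 0 else msPot h (P1Q.act (deltaMat p) x) := by
  haveI : NeZero p := ⟨(Fact.out : p.Prime).ne_zero⟩
  rcases P1Q.infty_or_ofRat x with rfl | ⟨r, rfl⟩
  · simp_rw [act_heckeRep_some_infty, act_deltaMat_infty, msPot_infty]
    simp
  · rw [msPot_ofRat, modularSymbol_heckeT_eq_sum p h Fact.out r]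
    simp_rw [act_heckeRep_some_ofRat, act_deltaMat_ofRat, msPot_ofRat]
    rw [← sum_zmod_val_eq_sum_fin p (fun n : ℕ => modularSymbol h ((r + (n : ℤ)) / p))]

/-- **`T_p {x, y}_h = {x, y}_{T_p h}`**: the abstract Hecke operator on `Symb(Sym⁰ ℂ)` acts through the
tree's `T_p` on `S₂(Γ₀(N))`. [cite: CremonaAlgorithms1997, §2.4] -/
theorem hecke_clSymb [NeZero N] :
    (CoeffActionOn.symPowOn S 0 ℂ).hecke N p (clSymb h) = clSymb (heckeT (Gamma0 N) 2 p h) := by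
  haveI : NeZero p := ⟨(Fact.out : p.Prime).ne_zero⟩
  funext x y i
  rw [CoeffActionOn.hecke_apply, Finset.sum_apply, Finset.sum_apply, Finset.sum_apply]
  simp_rw [symPowOn_zero_slash_apply, clSymb_apply]
  rw [Finset.sum_sub_distrib, msPot_heckeT, msPot_heckeT,
    sum_heckeIdx N p (fun i => msPot h (P1Q.act (heckeRep p i) y)), sum_heckeIdx N p (fun i => msPot h (P1Q.act (heckeRep p i) x)),
    heckeRep_none_eq_deltaMat]

/-- **A `T_p`-eigenform gives a `T_p`-eigensymbol.** [folklore] -/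
theorem hecke_clSymb_of_eigen [NeZero N] {ap : ℂ} (heig : heckeT (Gamma0 N) 2 p h = ap • h) :
    (CoeffActionOn.symPowOn S 0 ℂ).hecke N p (clSymb h) = ap • clSymb h := by
  rw [hecke_clSymb, heig, clSymb_smul]

/-- **The `p`-stabilised weight-`2` eigensymbol** (the symbol of `h_α = h − (p/α) h(p·)`): for a
`T_p`-eigenform `h ∈ S₂(Γ₀(N))`, `p ∤ N`, and `α ≠ 0` with `α² − a_p α + p = 0`,
`{x,y}_h − α⁻¹ {δx, δy}_h ∈ Symb_{Γ₀(Np)}(Sym⁰ ℂ)` is a `U_p`-eigensymbol with eigenvalue `α`.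
[cite: MazurTateTeitelbaum1986Invent, §I.10] -/
theorem clSymb_pStabilise [NeZero N] (hpN : ¬ p ∣ N) (hS : ∀ M : Matrix (Fin 2) (Fin 2) ℤ, M.det ≠ 0 → M ∈ S) {ap : ℂ}
    (heig : heckeT (Gamma0 N) 2 p h = ap • h) (α : ℂˣ) (hα : (α : ℂ) ^ 2 - ap * α + p = 0) :
    clSymb h - ((α⁻¹ : ℂˣ) : ℂ) • (CoeffActionOn.symPowOn S 0 ℂ).slash (deltaMat p) (clSymb h) ∈
        (CoeffActionOn.symPowOn S 0 ℂ).Symb (Gamma0 (N * p)) ∧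
      (CoeffActionOn.symPowOn S 0 ℂ).hecke (N * p) p
          (clSymb h - ((α⁻¹ : ℂˣ) : ℂ) • (CoeffActionOn.symPowOn S 0 ℂ).slash (deltaMat p) (clSymb h)) =
        (α : ℂ) • (clSymb h - ((α⁻¹ : ℂˣ) : ℂ) • (CoeffActionOn.symPowOn S 0 ℂ).slash (deltaMat p) (clSymb h)) := by
  haveI : NeZero p := ⟨(Fact.out : p.Prime).ne_zero⟩
  have hp : p ≠ 0 := (Fact.out : p.Prime).ne_zero
  refine symPow_pStabilise hp hpN (hS _ ?_) (fun j => hS _ ?_) (fun γ _ => hS _ ?_) (clSymb_mem_Symb h S) (hecke_clSymb_of_eigen h S heig) α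
    (by rw [zero_add, pow_one]; exact hα)
  · rw [det_deltaMat]; exact_mod_cast hp
  · rw [det_heckeRep]; exact_mod_cast hp
  · rw [Matrix.SpecialLinearGroup.det_coe]; exact one_ne_zero

end Hecke

end Literature.NumberTheory.EllipticCurves

end
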